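import Literature.Topology.FourManifolds.TrisectionsTopFaceLevel
import Literature.Topology.FourManifolds.TrisectionsZetaFrame
import Literature.Topology.FourManifolds.TrisectionsTopFaceSection
import HarnessLib

/-!
# The Morse function of the top face: definition, smoothness, and the section regime

Topic `Literature/Topology/FourManifolds`; step G (part c-1) of a Morse-theoretic construction
of Gay–Kirby's trisection for the fact seat
`provefact-Literature.Topology.FourManifolds.exists_isBalancedGKTrisection` (Gay–Kirby 2016,
Thm. 4 via §4, Lemma 14).  Everything in this file is **proved**; the definitions are explicit.

On the regular zero set `N = {γ = 0}` of the gap function (`TrisectionsTopFaceLevel.lean`) we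
consider the function `Φ_N = (Θ + ε₄ β) ∘ incl` where `Θ` is the **inner weight function** —
`φ̄` off the chart zones, `c₀ 𝒯̂_j` on them: the weight of `TrisectionsSectorWeight.lean` with
the identity profile (`HandleBoxes.theta`) — and `β` is the **belt term**
`Σ_j 1_{source_j} χ(A_j) · y₂∘coord_j` supported near the cores of the zones
(`HandleBoxes.beltTerm`).  Both are smooth on the band (`contMDiffAt_theta`,
`contMDiffAt_beltTerm`).  At a point `z ∈ N` whose trajectory meets `Y` and all of whose chart
coordinates have `A_j > a_R/2` — the flow-rule region, the tube saturation and the shell of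
the zones — `Θ = φ̄ = g ∘ λ̂` and `β = 0` near `z`, so by the **section flow rule**
(`TrisectionsTopFaceSection.lean`) `Φ_N` is critical at `z` iff the Heegaard function `g` is
critical at the landing point `λ̂ z`, with the same nondegeneracy and Morse index
(`morseData_phiN_of_hit`).

## References

* D. Gay, R. Kirby, *Trisecting 4-manifolds*, Geom. Topol. 20 (2016), §4, Lemma 14. [GayKirby2016]
* J. Milnor, *Lectures on the h-cobordism theorem* (1965), Thm. 3.4, Thm. 4.1. [MilnorHCobordism1965]
* J. Milnor, *Morse theory* (1963), §2. [Milnor1963]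
-/

open scoped Manifold ContDiff Topology
open Set Function Filter

noncomputable section

universe u

namespace Literature.Topology.FourManifolds

open Flow

/-- Local notation: `𝔼 n` is the model Euclidean space `EuclideanSpace ℝ (Fin n)`. -/
local notation "𝔼 " n:arg => EuclideanSpace ℝ (Fin n)

variable {X : Type u} [TopologicalSpace X] [T2Space X] [CompactSpace X] [ChartedSpace (𝔼 4) X]
  [IsManifold (𝓡 4) ∞ X]

namespace HandleBoxes

variable {f : X → ℝ} {ξ : Π x : X, TangentSpace (𝓡 4) x} {a η : ℝ} {ι : Type} [Fintype ι]
  (H : HandleBoxes f ξ a η ι)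
  {hξ : ContMDiff (𝓡 4) (𝓡 4).tangent ∞ fun x => (⟨x, ξ x⟩ : TangentBundle (𝓡 4) X)}
  {h : IsRegularLevel (𝓡 4) f a} {φ : RegularLevel h → ℝ} {ρ χb : ℝ → ℝ} {c₀ ε κ aR ε₄ : ℝ}

/-- **The inner weight function** `Θ`: `c₀ 𝒯̂_j` on the chart zones, `φ̄` elsewhere (the weight
with the identity profile). [cite: GayKirby2016, §4, Lemma 14] -/
def theta (hξ : ContMDiff (𝓡 4) (𝓡 4).tangent ∞ fun x => (⟨x, ξ x⟩ : TangentBundle (𝓡 4) X))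
    (h : IsRegularLevel (𝓡 4) f a) (φ : RegularLevel h → ℝ) (ρ : ℝ → ℝ) (c₀ ε κ aR : ℝ) : X → ℝ :=
  H.weight hξ h φ (fun t => t) ρ c₀ ε κ aR

/-- `Θ = φ̄` off the chart zones. [folklore] -/
theorem theta_of_forall_not_mem {z : X} (hz : ∀ j, z ∉ H.zone aR j) :
    H.theta hξ h φ ρ c₀ ε κ aR z = flowLift hξ h φ z :=
  H.weight_of_forall_not_mem hz

/-- `Θ = c₀ 𝒯̂_j` on the chart zone. [folklore] -/
theorem theta_of_mem_zone {j : ι} {z : X} (hz : z ∈ H.zone aR j) :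
    H.theta hξ h φ ρ c₀ ε κ aR z = c₀ * H.tubeHat ε κ ρ j z :=
  H.weight_of_mem_zone hz

/-- **`Θ` is smooth on the band.** [cite: GayKirby2016, §4, Lemma 14] -/
theorem contMDiffAt_theta (hgl : IsGradientLike (𝓡 4) f ξ) (hfM : IsMorse (𝓡 4) f)
    (hφs : ContMDiff (𝓡 3) 𝓘(ℝ, ℝ) ∞ φ) (hρs : ContDiff ℝ ∞ ρ)
    (hε : 0 ≤ ε) (hκ : 0 ≤ κ) {δ' : ℝ} (haR : 0 < aR) (haR2 : 2 * aR ≤ η)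
    (hρ : ∀ A, aR / 2 ≤ A → A ≤ 2 * aR → ρ A = A⁻¹)
    (hκδ : κ / η * (2 * aR) * (2 * η) < 2 * δ')
    (hφ : ∀ j (y : RegularLevel h), y.1 ∈ (H.box j).chart.source →
      TubeModel.tube ε κ η ((H.box j).coord y.1) < 1 + 2 * δ' →
      φ y = c₀ * TubeModel.tube ε κ η ((H.box j).coord y.1))
    {z : X} (hf₁ : a - η < f z) (hf₂ : f z < a + 2 * η) :
    ContMDiffAt (𝓡 4) 𝓘(ℝ, ℝ) ∞ (H.theta hξ h φ ρ c₀ ε κ aR) z :=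
  H.contMDiffAt_weight hgl hfM hφs contDiff_id hρs hε hκ haR haR2 hρ hκδ hφ hf₁ hf₂

/-- **`Θ = φ̄` near a band point all of whose chart coordinates have `A_j > a_R/2`.** [cite: GayKirby2016, §4, Lemma 14] -/
theorem theta_eventuallyEq_flowLift (hgl : IsGradientLike (𝓡 4) f ξ) (hfM : IsMorse (𝓡 4) f)
    (hε : 0 ≤ ε) (hκ : 0 ≤ κ) {δ' : ℝ} (haR2 : 2 * aR ≤ η)
    (hρ : ∀ A, aR / 2 ≤ A → A ≤ 2 * aR → ρ A = A⁻¹)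
    (hκδ : κ / η * (2 * aR) * (2 * η) < 2 * δ')
    (hφ : ∀ j (y : RegularLevel h), y.1 ∈ (H.box j).chart.source →
      TubeModel.tube ε κ η ((H.box j).coord y.1) < 1 + 2 * δ' →
      φ y = c₀ * TubeModel.tube ε κ η ((H.box j).coord y.1))
    {z : X} (hf₂ : f z < a + 2 * η) (hA : ∀ j, z ∈ (H.box j).chart.source → aR / 2 < H.A j z) :
    H.theta hξ h φ ρ c₀ ε κ aR =ᶠ[𝓝 z] flowLift hξ h φ :=
  H.weight_eventuallyEq_w_flowLift (w := fun t => t) hgl hfM hε hκ haR2 hρ hκδ hφ hf₂ hA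

/-! ### The belt term -/

/-- The belt coordinate `y₂` of the box chart. [folklore] -/
def yTwo (j : ι) (z : X) : ℝ := (H.box j).coord z 2

/-- **The belt term** `β = Σ_j 1_{source_j} · χ_b(A_j) · y₂`. [cite: GayKirby2016, §4, Lemma 14] -/
def beltTerm (χb : ℝ → ℝ) (z : X) : ℝ :=
  ∑ j, ((H.box j).chart.source).indicator (fun z' => χb (H.A j z') * H.yTwo j z') z

omit [T2Space X] [CompactSpace X] [IsManifold (𝓡 4) ∞ X] in
/-- On `source_j` the belt term is `χ_b(A_j) y₂`. [folklore] -/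
theorem beltTerm_of_mem_source {j : ι} {z : X} (hz : z ∈ (H.box j).chart.source) :
    H.beltTerm χb z = χb (H.A j z) * H.yTwo j z := by
  unfold beltTerm
  rw [Finset.sum_eq_single j]
  · rw [indicator_of_mem hz]
  · intro i _ hij
    rw [indicator_of_notMem]
    exact fun hi => (H.disjoint hij).le_bot ⟨hi, hz⟩
  · intro hj; exact absurd (Finset.mem_univ j) hj

omit [T2Space X] [CompactSpace X] [IsManifold (𝓡 4) ∞ X] in
/-- Off the chart domains the belt term vanishes. [folklore] -/
theorem beltTerm_of_forall_not_mem {z : X} (hz : ∀ j, z ∉ (H.box j).chart.source) : H.beltTerm χb z = 0 := by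
  unfold beltTerm
  exact Finset.sum_eq_zero fun j _ => indicator_of_notMem (hz j) _

omit [T2Space X] [CompactSpace X] [IsManifold (𝓡 4) ∞ X] in
/-- The belt term vanishes where every chart coordinate has `A_j ≥ a_b` (`χ_b = 0` on `[a_b, ∞)`). [folklore] -/
theorem beltTerm_eq_zero_of_le {ab : ℝ} (hχ : ∀ A, ab ≤ A → χb A = 0) {z : X}
    (hz : ∀ j, z ∈ (H.box j).chart.source → ab ≤ H.A j z) : H.beltTerm χb z = 0 := by
  by_cases h1 : ∃ j, z ∈ (H.box j).chart.source
  · obtain ⟨j, hj⟩ := h1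
    rw [H.beltTerm_of_mem_source hj, hχ _ (hz j hj), zero_mul]
  · push Not at h1
    exact H.beltTerm_of_forall_not_mem h1

omit [T2Space X] [CompactSpace X] [IsManifold (𝓡 4) ∞ X] [Fintype ι] in
/-- `y₂` is smooth on the chart domain. [folklore] -/
theorem contMDiffAt_yTwo {j : ι} {z : X} (hz : z ∈ (H.box j).chart.source) :
    ContMDiffAt (𝓡 4) 𝓘(ℝ, ℝ) ∞ (H.yTwo j) z := by
  have hc : ContMDiffAt (𝓡 4) 𝓘(ℝ, 𝔼 4) ∞ (H.box j).coord z :=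
    ((H.box j).chart.contMDiffAt_extend (H.box j).mem_maximalAtlas hz).sub contMDiffAt_const
  exact ((EuclideanSpace.proj (2 : Fin 4) : 𝔼 4 →L[ℝ] ℝ).contDiff.contMDiff.contMDiffAt).comp z hc

omit [CompactSpace X] in
/-- **The belt term is smooth on the band** when `χ_b` is smooth and vanishes on `[a_b, ∞)`
with `a_b ≤ η`. [cite: GayKirby2016, §4, Lemma 14] -/
theorem contMDiffAt_beltTerm (hfM : IsMorse (𝓡 4) f) (hχs : ContDiff ℝ ∞ χb) {ab : ℝ} (hab : ab ≤ η)
    (hχ : ∀ A, ab ≤ A → χb A = 0) {z : X} (hf₂ : f z < a + 2 * η) :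
    ContMDiffAt (𝓡 4) 𝓘(ℝ, ℝ) ∞ (H.beltTerm χb) z := by
  have hcontf : Continuous f := hfM.contMDiff.continuous
  by_cases h1 : ∃ j, z ∈ (H.box j).chart.source
  · obtain ⟨j, hz⟩ := h1
    have hev : H.beltTerm χb =ᶠ[𝓝 z] fun z' => χb (H.A j z') * H.yTwo j z' := by
      filter_upwards [(H.box j).chart.open_source.mem_nhds hz] with w hw
      exact H.beltTerm_of_mem_source hw
    refine ContMDiffAt.congr_of_eventuallyEq ?_ hev
    exact ((hχs.contMDiff.contMDiffAt).comp z (H.contMDiffAt_A hz)).mul (H.contMDiffAt_yTwo hz)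
  · push Not at h1
    have hev1 : ∀ i, ∀ᶠ w in 𝓝 z, w ∉ H.zone ab i := fun i =>
      H.eventually_not_mem_zone_of_not_mem_source hab hcontf (h1 i) hf₂
    have hev : H.beltTerm χb =ᶠ[𝓝 z] fun _ => 0 := by
      filter_upwards [Filter.eventually_all.2 hev1] with w hw
      refine H.beltTerm_eq_zero_of_le hχ fun j hj => ?_
      by_contra hlt; push Not at hlt; exact hw j ⟨hj, hlt⟩
    exact contMDiffAt_const.congr_of_eventuallyEq hev

omit [CompactSpace X] [IsManifold (𝓡 4) ∞ X] in
/-- The belt term vanishes near a point all of whose chart coordinates have `A_j > a_b`. [folklore] -/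
theorem beltTerm_eventuallyEq_zero (hfM : IsMorse (𝓡 4) f) {ab : ℝ} (hab : ab ≤ η) (hχ : ∀ A, ab ≤ A → χb A = 0)
    {z : X} (hf₂ : f z < a + 2 * η) (hA : ∀ j, z ∈ (H.box j).chart.source → ab < H.A j z) :
    H.beltTerm χb =ᶠ[𝓝 z] fun _ => 0 := by
  have hcontf : Continuous f := hfM.contMDiff.continuous
  have hev1 : ∀ i, ∀ᶠ w in 𝓝 z, w ∈ (H.box i).chart.source → ab ≤ H.A i w := by
    intro i
    by_cases hi : z ∈ (H.box i).chart.source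
    · have hcA : ContinuousAt (H.A i) z := (H.continuousOn_A i).continuousAt ((H.box i).chart.open_source.mem_nhds hi)
      filter_upwards [hcA.eventually (Ioi_mem_nhds (hA i hi))] with w hw _
      exact le_of_lt hw
    · filter_upwards [H.eventually_not_mem_zone_of_not_mem_source hab hcontf hi hf₂] with w hw hws
      by_contra hlt; push Not at hlt; exact hw ⟨hws, hlt⟩
  filter_upwards [Filter.eventually_all.2 hev1] with w hw
  exact H.beltTerm_eq_zero_of_le hχ hw

/-! ### The function of the top face -/

/-- **The ambient function of the top face** `Φ = Θ + ε₄ β`. [cite: GayKirby2016, §4, Lemma 14] -/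
def phiN (hξ : ContMDiff (𝓡 4) (𝓡 4).tangent ∞ fun x => (⟨x, ξ x⟩ : TangentBundle (𝓡 4) X))
    (h : IsRegularLevel (𝓡 4) f a) (φ : RegularLevel h → ℝ) (ρ χb : ℝ → ℝ) (c₀ ε κ aR ε₄ : ℝ) (z : X) : ℝ :=
  H.theta hξ h φ ρ c₀ ε κ aR z + ε₄ * H.beltTerm χb z

/-- **`Φ` is smooth on the band.** [cite: GayKirby2016, §4, Lemma 14] -/
theorem contMDiffAt_phiN (hgl : IsGradientLike (𝓡 4) f ξ) (hfM : IsMorse (𝓡 4) f)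
    (hφs : ContMDiff (𝓡 3) 𝓘(ℝ, ℝ) ∞ φ) (hρs : ContDiff ℝ ∞ ρ) (hχs : ContDiff ℝ ∞ χb)
    (hε : 0 ≤ ε) (hκ : 0 ≤ κ) {δ' ab : ℝ} (haR : 0 < aR) (haR2 : 2 * aR ≤ η)
    (hρ : ∀ A, aR / 2 ≤ A → A ≤ 2 * aR → ρ A = A⁻¹)
    (hκδ : κ / η * (2 * aR) * (2 * η) < 2 * δ')
    (hφ : ∀ j (y : RegularLevel h), y.1 ∈ (H.box j).chart.source →
      TubeModel.tube ε κ η ((H.box j).coord y.1) < 1 + 2 * δ' →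
      φ y = c₀ * TubeModel.tube ε κ η ((H.box j).coord y.1))
    (hab : ab ≤ η) (hχ : ∀ A, ab ≤ A → χb A = 0)
    {z : X} (hf₁ : a - η < f z) (hf₂ : f z < a + 2 * η) :
    ContMDiffAt (𝓡 4) 𝓘(ℝ, ℝ) ∞ (H.phiN hξ h φ ρ χb c₀ ε κ aR ε₄) z :=
  (H.contMDiffAt_theta hgl hfM hφs hρs hε hκ haR haR2 hρ hκδ hφ hf₁ hf₂).add
    (contMDiffAt_const.mul (H.contMDiffAt_beltTerm hfM hχs hab hχ hf₂))

end HandleBoxes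

/-! ### The section regime on the top face -/

namespace BiCollar

variable (B : BiCollar X) (Z : B.ZFrame) {η : ℝ} {ι : Type} [Fintype ι] (H : HandleBoxes B.f Z.ζ B.a η ι)
  {ρ χb : ℝ → ℝ} {c₀ ε κ aR ε₄ : ℝ} {γ : X → ℝ}

/-- **The section regime of the top-face function.**  Let `z ∈ N = γ⁻¹(0)` (with `γ`
transversal, `N` in the band) hit the level `Y`, with all chart coordinates `A_j(z) > a_R/2`
and `> a_b` (the support bound of the belt cut-off).  Then `Φ_N = (Θ + ε₄β) ∘ incl` is critical
at `z` iff the Heegaard function `g` is critical at the landing point `λ̂ z`, and then the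
Hessians are simultaneously nondegenerate and the Morse indices agree.
[cite: GayKirby2016, §4, Lemma 14] [cite: MilnorHCobordism1965, Thm. 4.1] [cite: Milnor1963, §2] -/
theorem morseData_phiN_of_hit
    (hγs : ContMDiff (𝓡 4) 𝓘(ℝ, ℝ) ∞ γ) (htr : ∀ x, γ x = 0 → 0 < mlineDeriv (𝓡 4) γ x (B.U.ξ x))
    (hγ : IsRegularLevel (𝓡 4) γ 0) [Nonempty (RegularLevel hγ)]
    (hε : 0 ≤ ε) (hκ : 0 ≤ κ) {δ' ab : ℝ} (haR2 : 2 * aR ≤ η)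
    (hρ : ∀ A, aR / 2 ≤ A → A ≤ 2 * aR → ρ A = A⁻¹)
    (hκδ : κ / η * (2 * aR) * (2 * η) < 2 * δ')
    (hφ : ∀ j (y : RegularLevel B.hf), y.1 ∈ (H.box j).chart.source →
      TubeModel.tube ε κ η ((H.box j).coord y.1) < 1 + 2 * δ' →
      B.g y = c₀ * TubeModel.tube ε κ η ((H.box j).coord y.1))
    (hab : ab ≤ η) (hχ : ∀ A, ab ≤ A → χb A = 0)
    (z : RegularLevel hγ) (hf₂ : B.f z.1 < B.a + 2 * η) (hzh : B.Hit z.1)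
    (hA : ∀ j, z.1 ∈ (H.box j).chart.source → aR / 2 < H.A j z.1 ∧ ab < H.A j z.1) :
    (IsMCriticalPt (𝓡 3) (H.phiN Z.hζ B.hf B.g ρ χb c₀ ε κ aR ε₄ ∘ RegularLevel.incl hγ) z ↔
        IsMCriticalPt (𝓡 3) B.g (B.lamLift z.1)) ∧
      (IsMCriticalPt (𝓡 3) B.g (B.lamLift z.1) →
        ((mhessian (𝓡 3) (H.phiN Z.hζ B.hf B.g ρ χb c₀ ε κ aR ε₄ ∘ RegularLevel.incl hγ) z).Nondegenerate ↔
            (mhessian (𝓡 3) B.g (B.lamLift z.1)).Nondegenerate) ∧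
          morseIndex (𝓡 3) (H.phiN Z.hζ B.hf B.g ρ χb c₀ ε κ aR ε₄ ∘ RegularLevel.incl hγ) z =
            morseIndex (𝓡 3) B.g (B.lamLift z.1)) := by
  have hfM := Z.Fr.isMorse
  have hgl := Z.hgl
  set y₀ : B.Y := B.lamLift z.1 with hy₀
  -- `z = π_N(y₀)`
  have hy₀1 : y₀.1 = B.lam z.1 := B.incl_lamLift hzh
  obtain ⟨t₀, ht₀⟩ : ∃ t₀, B.lam z.1 = B.U.fl z.1 t₀ := ⟨_, rfl⟩
  have hzN : B.HitN γ z.1 := hits_of_apply_eq (B.isSmoothFlow_θU.map_zero _) z.2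
  have hy₀N : B.HitN γ y₀.1 := by rw [hy₀1, ht₀]; exact (B.hitN_fl_iff t₀).2 hzN
  have hproj : B.projN γ y₀.1 = z.1 := by
    rw [hy₀1, ht₀, B.projN_fl hγs htr hzN, B.projN_of_apply_eq hγs htr z.2]
  have hpt : (B.sectionParam hγs htr Z.Fr hγ y₀).lift (chartAt (𝔼 3) y₀ y₀) = z := by
    apply (RegularLevel.isEmbedding_incl hγ).injective
    rw [B.incl_lift_chart hγs htr Z.Fr hγ hy₀N, hproj]
  -- `Φ = g ∘ λ̂` near `z`
  have hΘ := H.theta_eventuallyEq_flowLift (hξ := Z.hζ) (h := B.hf) (φ := B.g) (ρ := ρ) (c₀ := c₀)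
    hgl hfM hε hκ haR2 hρ hκδ hφ hf₂ fun j hj => (hA j hj).1
  have hβ := H.beltTerm_eventuallyEq_zero (χb := χb) hfM hab hχ hf₂ fun j hj => (hA j hj).2
  have hhit : ∀ᶠ w in 𝓝 z.1, B.Hit w := Z.Fr.isOpen_setOf_hit.mem_nhds hzh
  have hevX : ∀ᶠ w in 𝓝 z.1, H.phiN Z.hζ B.hf B.g ρ χb c₀ ε κ aR ε₄ w = B.g (B.lamLift w) := by
    filter_upwards [hΘ, hβ, hhit] with w hw hb hwh
    rw [HandleBoxes.phiN, hw, hb, mul_zero, add_zero, Z.flowLift_eq_g_lamLift hwh]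
  have hevN : ∀ᶠ w in 𝓝 z, (H.phiN Z.hζ B.hf B.g ρ χb c₀ ε κ aR ε₄ ∘ RegularLevel.incl hγ) w = B.g (B.lamLift w.1) :=
    continuous_subtype_val.continuousAt.eventually hevX
  have key := B.morseData_section hγs htr Z.Fr hγ hy₀N (Φ := H.phiN Z.hζ B.hf B.g ρ χb c₀ ε κ aR ε₄ ∘ RegularLevel.incl hγ)
    B.hg.contMDiff (by rw [hpt]; exact hevN)
  rw [hpt] at key
  exact key

/-- **The tube regime: no critical point of `Φ_N` over the tubes.**  Let `z ∈ N` (zero set of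
the gap function) lie in `source_j` with `A_j ≥ a_R` and `P_j < 2P_sw`.  Then `z` hits `Y`, its
landing point lies in the tube part of `Y` with the same `P_j > 0`, hence is not an axis
critical point of the Heegaard function — given that the critical points of `g` on the tube
part of `Y` are axis points (`B_j = 0`) — so by the section flow rule `Φ_N` is not critical at
`z`. [cite: GayKirby2016, §4, Lemma 14] -/
theorem not_isMCriticalPt_phiN_tube {h₂ TP χlo χhi : ℝ → ℝ} {Spl Sbot Smin Psw : ℝ}
    (hγs : ContMDiff (𝓡 4) 𝓘(ℝ, ℝ) ∞ (H.gapFn Z.hζ B.hf B.g h₂ TP χlo χhi Spl Sbot Smin Psw))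
    (htr : ∀ x, H.gapFn Z.hζ B.hf B.g h₂ TP χlo χhi Spl Sbot Smin Psw x = 0 →
      0 < mlineDeriv (𝓡 4) (H.gapFn Z.hζ B.hf B.g h₂ TP χlo χhi Spl Sbot Smin Psw) x (B.U.ξ x))
    (hγ : IsRegularLevel (𝓡 4) (H.gapFn Z.hζ B.hf B.g h₂ TP χlo χhi Spl Sbot Smin Psw) 0) [Nonempty (RegularLevel hγ)]
    (hε : 0 ≤ ε) (hκ : 0 ≤ κ) {δ' ab P₁ v₁ β₀ : ℝ} (haR2 : 2 * aR ≤ η) (haR0 : 0 < aR)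
    (hρ : ∀ A, aR / 2 ≤ A → A ≤ 2 * aR → ρ A = A⁻¹)
    (hκδ : κ / η * (2 * aR) * (2 * η) < 2 * δ')
    (hφ : ∀ j (y : RegularLevel B.hf), y.1 ∈ (H.box j).chart.source →
      TubeModel.tube ε κ η ((H.box j).coord y.1) < 1 + 2 * δ' →
      B.g y = c₀ * TubeModel.tube ε κ η ((H.box j).coord y.1))
    (hab : ab ≤ η) (habR : ab < aR) (hχ : ∀ A, ab ≤ A → χb A = 0)
    (hPsw : 2 * Psw ≤ η ^ 2) (hP₁ : 2 * P₁ < Psw)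
    (hTP₂ : ∀ P, 2 * P₁ ≤ P → TP P = Spl) (hh₂v : ∀ t ≤ v₁, h₂ t = Spl)
    (hφv : ∀ j (y : RegularLevel B.hf), y.1 ∈ (H.box j).chart.source → H.P j y.1 < 2 * Psw → B.g y ≤ v₁)
    (hTP₁0 : TP 0 = η + β₀) (hβ₀ : 0 < β₀)
    (hTmem : ∀ z, H.topHeightBot Z.hζ B.hf B.g h₂ TP χlo χhi Spl Sbot Smin Psw z ∈ Icc (-Smin) Sbot)
    (hSmin : Smin < η / 2) (hSbot : Sbot < 2 * η)
    (hplateau : ∀ s, -η / 2 < s → s ≤ Sbot → χlo s = 1 ∧ χhi s = 1)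
    (hgtube : ∀ (j : ι) (y : B.Y), y.1 ∈ (H.box j).chart.source → H.P j y.1 < 2 * Psw →
      IsMCriticalPt (𝓡 3) B.g y → H.B j y.1 = 0)
    {j : ι} (z : RegularLevel hγ) (hzj : z.1 ∈ (H.box j).chart.source) (hA : aR ≤ H.A j z.1) (hP : H.P j z.1 < 2 * Psw) :
    ¬ IsMCriticalPt (𝓡 3) (H.phiN Z.hζ B.hf B.g ρ χb c₀ ε κ aR ε₄ ∘ RegularLevel.incl hγ) z := by
  have hη := H.eta_pos
  have hfM := Z.Fr.isMorse
  have hgl := Z.hgl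
  -- `z` lies in the band and the plateau
  obtain ⟨hl, hu⟩ := hTmem z.1
  have hs : B.f z.1 - B.a = H.topHeightBot Z.hζ B.hf B.g h₂ TP χlo χhi Spl Sbot Smin Psw z.1 := by
    have h0 : H.gapFn Z.hζ B.hf B.g h₂ TP χlo χhi Spl Sbot Smin Psw z.1 = 0 := z.2
    rw [HandleBoxes.gapFn_apply] at h0; linarith
  have hf₁ : B.a - η < B.f z.1 := by linarith
  have hf₂ : B.f z.1 < B.a + 2 * η := by linarith
  obtain ⟨hlo, hhi⟩ := hplateau (B.f z.1 - B.a) (by linarith) (by linarith)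
  -- `B_j(z) > 0`: otherwise `γ(z) = -A_j - β₀ < 0`
  have hApos : 0 < H.A j z.1 := by linarith
  have hBpos : 0 < H.B j z.1 := by
    rcases (H.B_nonneg j z.1).eq_or_lt with hB0 | hB0
    · exfalso
      have hP0 : H.P j z.1 = 0 := by rw [HandleBoxes.P_def, ← hB0, mul_zero]
      have hT : H.topHeightBot Z.hζ B.hf B.g h₂ TP χlo χhi Spl Sbot Smin Psw z.1 = η + β₀ := by
        rw [H.topHeightBot_eq_TP hgl hfM hPsw hP₁ hTP₂ hh₂v hφv hzj hP hf₁ hf₂ hlo hhi, hP0, hTP₁0]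
      have hfz := H.apply_eq hzj
      rw [← hB0] at hfz
      have hA0 := H.A_nonneg j z.1
      linarith
    · exact hB0
  -- `z` hits `Y`
  have hhit : B.Hit z.1 := by
    rcases H.hits_or_exists_A_eq_zero (hξ := Z.hζ) hgl hfM hf₁ hf₂ with hh | ⟨i, hbox, hA0⟩
    · exact (Z.hit_iff _).2 hh
    · exfalso
      by_cases hij : i = j
      · subst hij; linarith
      · exact (H.disjoint hij).le_bot ⟨hbox.1, hzj⟩
  -- the landing point lies in the tube part with the same `P > 0`
  obtain ⟨hsrc, hPeq, -⟩ := H.exists_levelProj_mem hgl hfM hPsw hzj hP hf₁ hf₂ ((Z.hit_iff _).1 hhit)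
  have hy1 : (B.lamLift z.1).1 = levelProj Z.hζ B.f B.a z.1 := Z.incl_lamLift_eq hhit
  rw [(B.morseData_phiN_of_hit Z H hγs htr hγ hε hκ haR2 hρ hκδ hφ hab hχ z hf₂ hhit
    (fun i hi => by
      by_cases hij : i = j
      · subst hij; exact ⟨by linarith, by linarith⟩
      · exact absurd hzj (fun hzj' => (H.disjoint hij).le_bot ⟨hi, hzj'⟩))).1]
  intro hc
  have hB0 := hgtube j (B.lamLift z.1) (by rw [hy1]; exact hsrc) (by rw [hy1, hPeq]; exact hP) hc
  have hP0 : H.P j z.1 = 0 := by rw [← hPeq, ← hy1, HandleBoxes.P_def, hB0, mul_zero]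
  rw [HandleBoxes.P_def] at hP0
  rcases mul_eq_zero.1 hP0 with h0 | h0
  · linarith
  · linarith

end BiCollar

end Literature.Topology.FourManifolds

end
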